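import Mathlib
import HarnessLib
import Summits.CriticalPhenomena.CardyFormulaZ2.Theorems.CardyComplexConeEdgeCoherenceLeeYangDefs
import Literature.Analysis.Complex.VitaliConvergence

/-!
# Stub `stub_transfer` of line `Sketch` (composition `LeeYang`) for crux `CardyComplexCone.EdgeCoherence`

Route `CardyComplexCone` (sub-problem `CriticalPhenomena/CardyFormulaZ2`), crux
`Summit.CriticalPhenomena.CardyFormulaZ2.Theses.CardyComplexCone.EdgeCoherence` (item stmt-CriticalPhenomena-11385).
Helper file `--supports stmt-CriticalPhenomena-11385`: it proves, by name, the registered stub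
`stub_transfer : Sig.stub_transfer` of the definitions module
`Theorems/CardyComplexConeEdgeCoherenceLeeYangDefs.lean`, i.e. **TRANSFER** (Vitali–Porter, uniform in `h`):
for fixed `0 < η ≤ 1/2`, `0 ≤ M` and `ε' > 0` there is `ε > 0` such that every `h` holomorphic on the transfer
region `U_η = arcRegion η` with `‖h‖ ≤ M` on `U_η` and `‖h x‖ ≤ ε` on the real segment `|x - 1| < η` satisfies
`‖h ζ₀‖ ≤ ε'` at the physical fugacity `ζ₀ = e^{-iπ/6}`.

## Proof

By contradiction: if no `ε` works for some `ε' > 0`, choose `h_n` holomorphic on `U_η`, bounded by `M` there,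
bounded by `1/(n+1)` on the segment and with `‖h_n ζ₀‖ > ε'`. The sequence is uniformly (hence locally) bounded
and converges pointwise to `0` at every real `x` with `|x - 1| < η`; these points lie in `U_η`
(`ofReal_mem_arcRegion`) and are frequent in the punctured neighbourhood filter of `1 ∈ U_η`
(`frequently_nhdsNE_one_ofReal`). Vitali's theorem
(`Literature.Analysis.Complex.exists_tendstoLocallyUniformlyOn_of_frequently_tendsto`, `U_η` open and
preconnected) gives a holomorphic locally uniform limit `f` on `U_η`; `f = 0` on the segment (uniqueness of
pointwise limits), hence `f ≡ 0` on `U_η` by the identity theorem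
(`AnalyticOnNhd.eqOn_zero_of_preconnected_of_frequently_eq_zero`), so `h_n ζ₀ → 0`, contradicting
`‖h_n ζ₀‖ > ε'`.

Sources: E. C. Titchmarsh, *The Theory of Functions* §5.21 (Vitali); idea card
`Cruxes/EdgeCoherence/Ideas/lee-yang-winding-fugacity.md`. All analysis is proved inline from the tree's Vitali
theorem and Mathlib's identity theorem.
-/

noncomputable section

namespace Summit.CriticalPhenomena.CardyFormulaZ2.Cruxes.EdgeCoherence.LeeYang

open scoped Topology
open Filter Set

/-! ### Real points near `1` accumulate at `1` in the punctured plane -/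

/-- The real fugacities `x` with `|x - 1| < η` (`η > 0`) are frequent in the punctured neighbourhood filter of
`1` in `ℂ`: the inclusion `ℝ → ℂ` maps `𝓝[≠] 1` into `𝓝[≠] 1`, and `|t - 1| < η` holds near `1`. -/
theorem frequently_nhdsNE_one_ofReal {η : ℝ} (hη0 : 0 < η) :
    ∃ᶠ z in 𝓝[≠] (1 : ℂ), ∃ x : ℝ, |x - 1| < η ∧ (x : ℂ) = z := by
  have ht : Tendsto ((↑) : ℝ → ℂ) (𝓝[≠] (1 : ℝ)) (𝓝[≠] (1 : ℂ)) := by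
    have h1 : Tendsto ((↑) : ℝ → ℂ) (𝓝[≠] (1 : ℝ)) (𝓝[≠] ((1 : ℝ) : ℂ)) :=
      Complex.continuous_ofReal.continuousWithinAt.tendsto_nhdsWithin fun t ht => by
        simpa using ht
    simpa using h1
  have hca : Continuous fun t : ℝ => |t - 1| := (continuous_id.sub continuous_const).abs
  have h2 : ∀ᶠ t : ℝ in 𝓝 (1 : ℝ), |t - 1| < η :=
    hca.continuousAt.eventually_lt continuousAt_const (by simpa using hη0)
  refine ht.frequently ?_
  exact (h2.filter_mono nhdsWithin_le_nhds).frequently.mono fun t ht => ⟨t, ht, rfl⟩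

/-! ### The stub -/

/-- **Stub TRANSFER** (registered stub of line `Sketch`, composition `LeeYang`; Vitali–Porter, uniform in `h`):
for `0 < η ≤ 1/2`, `0 ≤ M` and `ε' > 0` there is `ε > 0` such that every `h` holomorphic on `arcRegion η` with
`‖h‖ ≤ M` there and `‖h x‖ ≤ ε` for real `|x - 1| < η` has `‖h ζ₀‖ ≤ ε'`. Contradiction + Vitali: a sequence
`h_n` with segment bounds `1/(n+1)` and `‖h_n ζ₀‖ > ε'` is bounded by `M`, tends to `0` on the segment (frequent
in `𝓝[≠] 1`, `frequently_nhdsNE_one_ofReal`), hence locally uniformly to a holomorphic `f`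
(`exists_tendstoLocallyUniformlyOn_of_frequently_tendsto`) vanishing on the segment, so `f ≡ 0` on the
preconnected region (identity theorem) and `h_n ζ₀ → 0`: absurd. -/
theorem stub_transfer : Sig.stub_transfer := by
  intro η M hη0 hη hM ε' hε'
  by_contra hcon
  push Not at hcon
  have hcon' : ∀ n : ℕ, ∃ h : ℂ → ℂ, DifferentiableOn ℂ h (arcRegion η) ∧
      (∀ z ∈ arcRegion η, ‖h z‖ ≤ M) ∧ (∀ x : ℝ, |x - 1| < η → ‖h (x : ℂ)‖ ≤ 1 / ((n : ℝ) + 1)) ∧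
      ε' < ‖h zeta0‖ := fun n => hcon _ (by positivity)
  choose F hFd hFM hFseg hFζ using hcon'
  have hUo : IsOpen (arcRegion η) := isOpen_arcRegion η
  have hUc : IsPreconnected (arcRegion η) := isPreconnected_arcRegion η
  have h1U : (1 : ℂ) ∈ arcRegion η := one_mem_arcRegion hη0 hη
  have hζU : zeta0 ∈ arcRegion η := zeta0_mem_arcRegion hη0 hη
  -- uniform, hence local, boundedness
  have hb : ∀ a ∈ arcRegion η, ∃ M' : ℝ, ∃ r > 0, ∀ n, ∀ z ∈ Metric.ball a r ∩ arcRegion η,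
      ‖F n z‖ ≤ M' := fun a _ => ⟨M, 1, one_pos, fun n z hz => hFM n z hz.2⟩
  -- pointwise convergence to `0` on the real segment
  have hpt : ∀ x : ℝ, |x - 1| < η → Tendsto (fun n => F n (x : ℂ)) atTop (𝓝 0) := fun x hx =>
    squeeze_zero_norm (fun n => hFseg n x hx) tendsto_one_div_add_atTop_nhds_zero_nat
  have hfreq := frequently_nhdsNE_one_ofReal (η := η) hη0
  have hS : ∃ᶠ z in 𝓝[≠] (1 : ℂ), ∃ c : ℂ, Tendsto (fun n => F n z) atTop (𝓝 c) :=
    hfreq.mono fun z ⟨x, hx, hz⟩ => ⟨0, hz ▸ hpt x hx⟩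
  -- Vitali
  obtain ⟨f, hf, hlim⟩ :=
    Literature.Analysis.Complex.exists_tendstoLocallyUniformlyOn_of_frequently_tendsto hUo hUc hFd hb
      h1U hS
  -- the limit vanishes on the segment, hence on the region (identity theorem)
  have hf0 : ∀ x : ℝ, |x - 1| < η → f x = 0 := fun x hx =>
    tendsto_nhds_unique (hlim.tendsto_at (ofReal_mem_arcRegion hη0 hη hx)) (hpt x hx)
  have hfz : ∃ᶠ z in 𝓝[≠] (1 : ℂ), f z = 0 := hfreq.mono fun z ⟨x, hx, hz⟩ => hz ▸ hf0 x hx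
  have hfU : EqOn f 0 (arcRegion η) :=
    (hf.analyticOnNhd hUo).eqOn_zero_of_preconnected_of_frequently_eq_zero hUc h1U hfz
  -- at the physical fugacity
  have hζ : Tendsto (fun n => F n zeta0) atTop (𝓝 0) := by
    have h := hlim.tendsto_at hζU
    rwa [hfU hζU] at h
  have hev : ∀ᶠ n in atTop, ‖F n zeta0‖ < ε' :=
    (tendsto_zero_iff_norm_tendsto_zero.1 hζ).eventually (Iio_mem_nhds hε')
  obtain ⟨n, hn⟩ := hev.exists
  exact absurd hn (not_lt.2 (hFζ n).le)

end Summit.CriticalPhenomena.CardyFormulaZ2.Cruxes.EdgeCoherence.LeeYang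

end
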